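import Mathlib.Analysis.SpecialFunctions.Pow.Deriv
import Mathlib.Analysis.Complex.CauchyIntegral
import Literature.NumberTheory.LFunctions.AdditiveTwistProofs
import Literature.NumberTheory.GaloisRepresentations.ArtinLFunctionRatLSeriesProofs
import HarnessLib

/-!
# Additive twists of two-dimensional Artin L-functions over `ℚ`: `L(s, ρ, α) ∈ V`, and the
# reduction of Booker's Lemma 1 to its analytic half
(pure proofs; companion to `Literature.NumberTheory.LFunctions.AdditiveTwist`)

A. R. Booker, *Poles of Artin L-functions and the strong Artin conjecture*, Ann. of Math. 158
(2003), Lemma 1 (p. 1092) and its proof (pp. 1092–1093).  The printed proof has two halves: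

1. (algebraic) "`L(s, ρ, α) ∈ V`", `V` the span of the `q^{-s} L(s, ρ ⊗ χ₀)`: the additive twist
   `∑ aₙ e(nα) n^{-s}` of the Dirichlet series of `L(s, ρ)` is a finite combination of Dirichlet
   monomials times character twists — proved for every coprime-multiplicative coefficient
   sequence in `AdditiveTwistProofs` (`LSeries.exists_addTwist_eq_sum_charTwist`), and the
   coefficients of `L(s, σ)` for `σ : Γ_ℚ → GL₂(ℂ)` ARE such a sequence
   (`GaloisRepresentations.FramedArtinRep.eq_of_LSeries_eq_artinLFunction_two`,
   `ArtinLFunctionRatLSeriesProofs`); combined here as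
   `exists_addTwist_eq_sum_charTwist_of_LSeries_eq_artinLFunction`;
2. (analytic) "each `L(s, ρ ⊗ χ₀)` satisfies the conclusion of the lemma" (meromorphic on `ℂ`,
   poles only in `0 < Re s < 1`; p. 1091: Hecke non-vanishing on `Re s ≥ 1`, the functional
   equation on `Re s ≤ 0`).

`Booker2003_lemma1_of_charTwist_continuation` proves the named fact
`Literature.NumberTheory.LFunctions.Booker2003_lemma1` from half 2 alone, stated for the naive
character twists `∑ aₙ χ(n) n^{-s}` (`χ` a Dirichlet character of any level `M ≥ 1`; these differ
from `L(s, σ ⊗ χ_prim)` by finitely many Euler factors, entire functions of `s`): given, for the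
`σ`, `a` of the fact and every such `χ`, a continuation of `∑ aₙ χ(n) n^{-s}` meromorphic on `ℂ`
and analytic at every `s` with `Re s ≤ 0` or `Re s ≥ 1`, the continuation of the additive twist
is `D(s) = ∑ᵢ cᵢ qᵢ^{-s} Dᵢ(s)` (finite sum; `qᵢ^{-s}` entire).  What remains for
`Booker2003_lemma1_holds` is therefore exactly half 2, which needs Artin's functional equation for
the twists (named fact `Literature.NumberTheory.Automorphic.artin_functional_equation`, not yet
discharged) and the regularity of Artin L-functions of non-trivial irreducible representations on
`Re s = 1` (cf. `Literature.NumberTheory.GaloisRepresentations.artinLFunction_order_at_one`);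
nothing here depends on those.

No definitions, no named facts.

## References

* [Booker2003] A. R. Booker, *Poles of Artin L-functions and the strong Artin conjecture*, Ann.
  of Math. 158 (2003), 1089–1098: Lemma 1 p. 1092, proof pp. 1092–1093; p. 1091.
-/

noncomputable section

open Finset Complex Filter

namespace Literature.NumberTheory.LFunctions

/-- **Booker 2003, proof of Lemma 1, "`L(s, ρ, α) ∈ V`" for a two-dimensional Artin
representation of `Γ_ℚ`.**  Let `σ : Γ_ℚ → GL₂(ℂ)` be a framed Artin representation and `a` any
sequence with `∑ aₙ n^{-s} = L(s, σ)` for `Re s > 1` (the Dirichlet coefficients of `L(s, σ)`;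
`GaloisRepresentations.artinLFunction`).  Then for every rational `x` there are finitely many
`cᵢ ∈ ℂ`, `qᵢ ≥ 1` and Dirichlet characters `χᵢ` mod `Mᵢ ≥ 1` with
`∑ aₙ e(nx) n^{-s} = ∑ᵢ cᵢ qᵢ^{-s} ∑ₙ aₙ χᵢ(n) n^{-s}` for all `Re s > 1` (`LSeries.addTwist`;
all series absolutely convergent there).  Proof: `a` is coprime-multiplicative on `n ≥ 1` with
`|aₙ| ≤ d(n)` (`FramedArtinRep.eq_of_LSeries_eq_artinLFunction_two`), so
`LSeries.exists_addTwist_eq_sum_charTwist` applies.  (No irreducibility or parity hypothesis is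
needed for this half.) [cite: Booker2003, proof of Lemma 1 pp. 1092–1093] -/
theorem exists_addTwist_eq_sum_charTwist_of_LSeries_eq_artinLFunction
    (σ : Literature.NumberTheory.GaloisRepresentations.FramedArtinRep ℚ 2) {a : ℕ → ℂ}
    (ha : ∀ s : ℂ, 1 < s.re →
      LSeries a s = Literature.NumberTheory.GaloisRepresentations.artinLFunction σ.toArtinRep s)
    (x : ℚ) :
    ∃ (ι : Type) (_ : Fintype ι) (c : ι → ℂ) (q : ι → ℕ) (M : ι → ℕ)
      (χ : (i : ι) → DirichletCharacter ℂ (M i)),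
      (∀ i, q i ≠ 0) ∧ (∀ i, M i ≠ 0) ∧ ∀ s : ℂ, 1 < s.re →
        LSeriesSummable a s ∧
        LSeries.addTwist a x s =
          ∑ i, c i * (q i : ℂ) ^ (-s) * LSeries (a * fun n : ℕ => χ i (n : ZMod (M i))) s := by
  obtain ⟨b, -, -, hbmul, -, hab, hbL⟩ := σ.eq_of_LSeries_eq_artinLFunction_two ha
  have hmul : ∀ m n : ℕ, m ≠ 0 → n ≠ 0 → m.Coprime n → a (m * n) = a m * a n := by
    intro m n hm hn hmn
    rw [hab _ (mul_ne_zero hm hn), hab _ hm, hab _ hn, hbmul m n hmn]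
  obtain ⟨ι, hι, c, q, M, χ, hq, hM, h⟩ := LSeries.exists_addTwist_eq_sum_charTwist a hmul x
  exact ⟨ι, hι, c, q, M, χ, hq, hM, fun s hs => ⟨(hbL s hs).1, h s (hbL s hs).1⟩⟩

/-- **Reduction of Booker 2003, Lemma 1 to its analytic half.**  Suppose that for every
irreducible even `σ : Γ_ℚ → GL₂(ℂ)`, every `a` with `∑ aₙ n^{-s} = L(s, σ)` on `Re s > 1`, and every
Dirichlet character `χ` of level `M ≥ 1`, the naive twist `∑ aₙ χ(n) n^{-s}` has a continuation
meromorphic on `ℂ` and analytic at every `s` with `Re s ≤ 0` or `Re s ≥ 1` (Booker, p. 1092: "each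
`L(s, ρ ⊗ χ₀)` satisfies the conclusion of the lemma"; p. 1091: "holomorphic in `Re s ≥ 1`, and by
the functional equation, in `Re s ≤ 0`").  Then the named fact `Booker2003_lemma1` holds: by
`exists_addTwist_eq_sum_charTwist_of_LSeries_eq_artinLFunction` the continuation of
`∑ aₙ e(nx) n^{-s}` is the finite sum `D(s) = ∑ᵢ cᵢ qᵢ^{-s} Dᵢ(s)`, meromorphic on `ℂ`
(Mathlib `MeromorphicOn.fun_sum`) and analytic wherever all `Dᵢ` are (`qᵢ^{-s}` is entire).
[cite: Booker2003, Lemma 1 p. 1092 and its proof] -/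
theorem Booker2003_lemma1_of_charTwist_continuation
    (h : ∀ (σ : Literature.NumberTheory.GaloisRepresentations.FramedArtinRep ℚ 2) (a : ℕ → ℂ),
      σ.toGaloisRep.IsIrreducible →
      (∀ (φ : ℚ →+* ℝ) (c : Field.absoluteGaloisGroup ℚ),
        Literature.NumberTheory.GaloisRepresentations.IsComplexConjugation φ c →
          Matrix.GeneralLinearGroup.det (σ c) = 1) →
      (∀ s : ℂ, 1 < s.re →
        LSeries a s =
          Literature.NumberTheory.GaloisRepresentations.artinLFunction σ.toArtinRep s) →
      ∀ (M : ℕ) (χ : DirichletCharacter ℂ M), M ≠ 0 →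
        ∃ D : ℂ → ℂ, MeromorphicOn D Set.univ ∧
          (∀ s : ℂ, s.re ≤ 0 ∨ 1 ≤ s.re → AnalyticAt ℂ D s) ∧
          ∀ s : ℂ, 1 < s.re → D s = LSeries (a * fun n : ℕ => χ (n : ZMod M)) s) :
    Booker2003_lemma1 := by
  intro σ a hirr heven ha x
  obtain ⟨ι, hι, c, q, M, χ, hq, hM, hsum⟩ :=
    exists_addTwist_eq_sum_charTwist_of_LSeries_eq_artinLFunction σ ha x
  choose D hDm hDa hDL using fun i => h σ a hirr heven ha (M i) (χ i) (hM i)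
  -- `s ↦ qᵢ^{-s}` is entire
  have hpow : ∀ (i : ι) (z : ℂ), AnalyticAt ℂ (fun s : ℂ => (q i : ℂ) ^ (-s)) z := by
    intro i z
    have hq0 : (q i : ℂ) ≠ 0 := by exact_mod_cast hq i
    have hd : Differentiable ℂ (fun s : ℂ => (q i : ℂ) ^ (-s)) :=
      differentiable_id.neg.const_cpow (Or.inl hq0)
    exact hd.analyticAt z
  have hmono : ∀ (i : ι) (z : ℂ), AnalyticAt ℂ (fun s : ℂ => c i * (q i : ℂ) ^ (-s)) z :=
    fun i z => analyticAt_const.mul (hpow i z)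
  refine ⟨fun s => ∑ i, c i * (q i : ℂ) ^ (-s) * D i s, ?_, ?_, ?_⟩
  · refine MeromorphicOn.fun_sum fun i => ?_
    intro z hz
    exact (hmono i z).meromorphicAt.mul (hDm i z hz)
  · intro s hs
    refine Finset.analyticAt_fun_sum _ fun i _ => ?_
    exact (hmono i s).mul (hDa i s hs)
  · intro s hs
    show ∑ i, c i * (q i : ℂ) ^ (-s) * D i s = LSeries.addTwist a x s
    rw [(hsum s hs).2]
    exact Finset.sum_congr rfl fun i _ => by rw [hDL i s hs]

end Literature.NumberTheory.LFunctions

end
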